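/-
Origin: expansion seat `planner-pub-hodgecm-pv13-g2-0`, handover #2 2026-08-18T05:11:06Z (`HOME/pub-hodgecm-pv13-g2/lean/Pv13/Li92FromPieces.lean`, md5 3e85efce, 155 lines);
landed by the gen-6 packager in gate run 22 as `HodgeCM/PerL34/Li92FromPieces.lean` (import ^import Pv[0-9]+\.→import HodgeCM.PerL34. ×1).
-/
/-
Origin: pub-hodgecm-pv13-g2 (DAG-NODE PROVER #13, gen 2; session planner-pub-hodgecm-pv13-g2-0) — seam S3 END TO END on
the Li92 route: gen-1 pv13's per-character constructor `LocalFactorPieces.toLocalFactorDatum` (run 21) and cluster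
record `EulerProduct.ClusterPieces` (`SideFromPieces`, run 22) with the opaque `AllowedBridge` REPLACED by the Li92
side dictionary of `Li92Bridge` (PRINT [Li92 Cor 5.5, p. 206] by name + labelled dictionary fields).
Imports: `HodgeCM.PerL34.SideFromPieces` (gen-1 pv13, run 22) and `HodgeCM.PerL34.Li92Bridge` (this seat, run 22;
itself after cf-kudla-howe-rallis-g2's `ThetaCorrespondence` v3) — this file lands AFTER both.
Proposed place: `HodgeCM/PerL34/Li92FromPieces.lean`, namespace `HodgeCM.PerL34.Li92Route`.
Nothing cited, nothing asserted: pure composition (kernel glue); every non-kernel input is a field of the two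
imported record types, labelled there.
-/
import Summits.HodgeConjecture.HodgeCM.PerL34.SideFromPieces
import Summits.HodgeConjecture.HodgeCM.PerL34.Li92Bridge_2

set_option autoImplicit false

/-!
# Seam S3 from pieces, Li92 route

`Li92Route.PiecesSide A D Pl` = the side dictionary `SideDict A D` (two `LineDict`s: print field `cor55` =
`Li92GlobalDatum.StableRangeNonvanishing`, D4 fields, the archimedean residual (r1) `inA10_of_howe`; (r3) `allowed_of` =
Definition 3.2) + two families of gen-1 `EulerFactorisation.LocalFactorPieces` (adelic shell, N31e statement, Petersson
identity, restricted-product `Datum`, local integrands, N31f/N31g local fields — every `Prop` field PRODUCED by an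
upstream node or definitional, see `LocalFactorPieces`) + the definitional memberships `θ_φ(χ'_j) ∈ V(θ, χ'_j)`.
OUTPUT: `PiecesSide.toSideOutputs : SideOutputs D Pl` (both `rallis` AND `allowed_of_pair` derived),
`Li92ClusterPieces T V c Pl` and `clusterOutputs_of_li92Pieces : (∀ good ctx, Nonempty (Li92ClusterPieces T V c Pl)) →
ClusterOutputs T` — the binder `h31` of the carver's `perL_of_leaves` / `perL_of_weilDictLeaves`.
COMPARISON with gen-1 `EulerProduct.ClusterPieces` (same `P₁ … P₄`): its `B₁₂/B₃₄ : AllowedBridge …` (two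
`ConstituentDictionary`s per character: (r1) archimedean package, (r2) isotypic projector family, (r2′-an) bounded
lifts, (D2)(D5) data, + `allowed_of`) is replaced by ONE `Ambient` + `SideDict` per side, in which the constituent
analysis is no longer an input: it is [Li92 Cor 5.5]'s irreducibility, consumed by name, + the kernel one-constituent
lemma `LineDict.constituent_eq`.
-/

noncomputable section

namespace HodgeCM
namespace PerL34
namespace Li92Route

open HodgeCM.Prior.Perl34File
open HodgeCM.PerL34.EulerProduct

section Side

variable {H HG CG G SK SigIdx SigIdxG : Type*}
variable [NormedAddCommGroup H] [InnerProductSpace ℂ H] [CompleteSpace H]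
variable [NormedAddCommGroup HG] [InnerProductSpace ℂ HG] [CompleteSpace HG]
variable [NormedAddCommGroup CG] [NormedSpace ℂ CG]
variable [Group G] [TopologicalSpace G] [TopologicalSpace SK]
variable {C : Perl34.IsolationCore H HG CG G SK SigIdx SigIdxG}

/-- **S3 inputs for one torus side on the Li92 route:** the side dictionary + the pieces of the two local-factor
data per character + the definitional memberships of the two lifts in Li's `V(θ, χ'_j)`. -/
structure PiecesSide (A : Ambient HG) (D : Perl34.TorusData C) (Pl : Type) [Countable Pl]
    extends SideDict A D where
  /-- pieces for the first line's lift `θ_φ(χ'₁)` (gen-1 `LocalFactorPieces`) -/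
  P₁ : D.X → EulerFactorisation.LocalFactorPieces Pl HG
  /-- pieces for the second line's lift `θ_φ(χ'₂)` -/
  P₂ : D.X → EulerFactorisation.LocalFactorPieces Pl HG
  /-- D4 (definitional): `θ_φ(χ'₁) ∈ V(θ, χ'₁)` ([Li92] (4)) -/
  P₁_mem : ∀ χ : D.X, (P₁ χ).theta ∈ line₁.Vθ χ
  /-- D4 (definitional): `θ_φ(χ'₂) ∈ V(θ, χ'₂)` -/
  P₂_mem : ∀ χ : D.X, (P₂ χ).theta ∈ line₂.Vθ χ

namespace PiecesSide

variable {A : Ambient HG} {D : Perl34.TorusData C} {Pl : Type} [Countable Pl]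

/-- The route-A side data of `Li92Bridge`, with the local-factor data BUILT from the pieces (`rallis` a theorem,
gen-1 `LocalFactorPieces.toLocalFactorDatum`). -/
def toAnalyticSide (S : PiecesSide A D Pl) : AnalyticSide A D Pl where
  toSideDict := S.toSideDict
  fst χ := (S.P₁ χ).toLocalFactorDatum
  snd χ := (S.P₂ χ).toLocalFactorDatum
  fst_mem χ := S.P₁_mem χ
  snd_mem χ := S.P₂_mem χ

/-- **S3 constructor for a side, Li92 route:** `SideOutputs D Pl` with `rallis` (inside `fst/snd`) AND
`allowed_of_pair` DERIVED. -/
def toSideOutputs (S : PiecesSide A D Pl) : SideOutputs D Pl :=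
  S.toAnalyticSide.toSideOutputs

/-- (Ported verbatim from the HodgeCMPerL package; no docstring in the source.) -/
@[simp] theorem toSideOutputs_fst (S : PiecesSide A D Pl) (χ : D.X) :
    S.toSideOutputs.fst χ = (S.P₁ χ).toLocalFactorDatum := rfl

/-- (Ported verbatim from the HodgeCMPerL package; no docstring in the source.) -/
@[simp] theorem toSideOutputs_snd (S : PiecesSide A D Pl) (χ : D.X) :
    S.toSideOutputs.snd χ = (S.P₂ χ).toLocalFactorDatum := rfl

/-- Lemma 4.2(b) for the side from pieces (Li92 route). -/
theorem allowed_all (S : PiecesSide A D Pl) : ∀ χ : D.X, D.allowed χ :=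
  S.toSideOutputs.allowed_all

/-- Both lifts of every character are non-zero (N31h (i), KERNEL from the pieces: Euler product). -/
theorem theta_ne_zero (S : PiecesSide A D Pl) (χ : D.X) :
    (S.P₁ χ).theta ≠ 0 ∧ (S.P₂ χ).theta ≠ 0 :=
  ⟨(S.P₁ χ).toLocalFactorDatum.theta_ne_zero, (S.P₂ χ).toLocalFactorDatum.theta_ne_zero⟩

end PiecesSide

end Side

/-! ### The whole cluster for the model -/

section Model

variable {U : Universe} (T : U.ThetaModel)

/-- **The pieces of the whole N31 cluster on the Li92 route** for the model `T` in one good context: one ambient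
dictionary for `L²([G_U])` and one `PiecesSide` per torus side.  Compare gen-1 `EulerProduct.ClusterPieces`
(`AllowedBridge`s instead of the side dictionaries). -/
structure Li92ClusterPieces {L : CMField} {ι₁ : L →+* ℂ} (V : HermSpace3 L ι₁) (c : SeesawCtx L)
    (Pl : Type) [Countable Pl] where
  /-- D2: the ambient `L²([G_U])` with its `G_U(𝔸)`-action and the predicate `𝒜^{1,0}` -/
  A : Ambient (T.HG L ι₁ V)
  /-- the side `T = U(W₁) × U(W₂)` -/
  S₁₂ : PiecesSide A (T.t12 V c) Pl
  /-- the side `T' = U(W₃) × U(W₄)` -/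
  S₃₄ : PiecesSide A (T.t34 V c) Pl

variable {T}

/-- Route-A inputs of `Li92Bridge` from cluster pieces. -/
theorem analyticInputs_of_li92Pieces {Pl : Type} [Countable Pl]
    (h : ∀ {L : CMField} {ι₁ : L →+* ℂ} (V : HermSpace3 L ι₁) (c : SeesawCtx L), T.GoodCtx ι₁ c →
      Nonempty (Li92ClusterPieces T V c Pl)) :
    AnalyticInputs T := by
  intro L ι₁ V c hc
  obtain ⟨p⟩ := h V c hc
  exact ⟨p.A, Pl, ⟨p.S₁₂.toAnalyticSide⟩, ⟨p.S₃₄.toAnalyticSide⟩⟩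

variable (T)

/-- **`ClusterOutputs T` — the binder `h31` of the carver's `perL_of_leaves` / `perL_of_weilDictLeaves` — from
Li92 cluster pieces in every good context.** -/
theorem clusterOutputs_of_li92Pieces {Pl : Type} [Countable Pl]
    (h : ∀ {L : CMField} {ι₁ : L →+* ℂ} (V : HermSpace3 L ι₁) (c : SeesawCtx L), T.GoodCtx ι₁ c →
      Nonempty (Li92ClusterPieces T V c Pl)) :
    ClusterOutputs T :=
  clusterOutputs_of_analytic T (analyticInputs_of_li92Pieces h)

/-- … hence Lemma 4.2(b) as typed (`N31_chars T`) and the open input `Open_chars`. -/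
theorem open_chars_of_li92Pieces {Pl : Type} [Countable Pl]
    (h : ∀ {L : CMField} {ι₁ : L →+* ℂ} (V : HermSpace3 L ι₁) (c : SeesawCtx L), T.GoodCtx ι₁ c →
      Nonempty (Li92ClusterPieces T V c Pl)) :
    T.Open_chars :=
  open_chars_of_cluster T (clusterOutputs_of_li92Pieces T h)

end Model

end Li92Route
end PerL34
end HodgeCM

end
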